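import Literature.AlgebraicGeometry.Frobenioids.PadicFrobenioidSplittingMonoid
import Literature.AlgebraicGeometry.Frobenioids.PadicFrobenioidDatumLemmas
import Literature.AlgebraicGeometry.Frobenioids.ModelFrobenioidAutAction
import HarnessLib

/-!
# Frobenioids II, Def. 2.2 (i) at the FROBENIOID level: the monoid `O^▷(A)` of an object of a `p`-adic
# Frobenioid with the conjugation action of `Aut_C(A)` (binding row (α), file D1)

Mochizuki, *The geometry of Frobenioids II*, Kyushu J. Math. **62** (2008) 401–460, §2, Definition 2.2
p. 17 [cite: MochizukiFrdII2008, Def 2.2 (i) p.17]: "`A ∈ Ob(C)` … Thus, we have a natural action [by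
conjugation] of `Aut_C(A)` on the monoid `O^⊳(A)` (which is commutative by [FrdI], Remark 1.3.1)";
[FrdI] Def. 1.2 (ii) (`O^▷(A)` = base-identity linear endomorphisms), Thm. 5.2 (i) (morphisms of a
model Frobenioid = quadruples `(deg_Fr, Base, Div, u)`).

Definitions file (seat abc-iut-L1-t7, gen 4; cell GAP row G-L1t7-α, piece D1). For a `p`-adic
Frobenioid `C = d.frobenioid` (abc-iut-L1-t4's `PadicFrd.Datum d`, the model Frobenioid of
`(Φ, B, Div_B)`) and an object `A`, the typed Definition 2.2 context (abc-iut-L1-t7's `Def22Context`,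
`ofGalois`) takes the monoid `O^□(A)` as a TYPE with a commutative cancellative monoid structure and a
`MulDistribMulAction` of `Aut_C(A)`. This file packages exactly that from landed material, no new
mathematics:
* `PadicFrd.Datum.ObjMonoid d A` — the type `O^▷(A)` (found's `PreFrobenioid.endSubmonoid` for the
  structure functor `C → F_Φ`), with `CommMonoid` (commutativity: the rational-function map
  `f ↦ u_f ∈ B(A_D)` is injective and multiplicative — abc-iut-L1-t4's `unit_comp_of_mem`,
  `eq_of_mem_of_unit_eq` — and `B(A_D)` is commutative; = [FrdI] Rmk. 1.3.1 for this Frobenioid) and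
  `IsCancelMul` (`B(A_D)` is a group, `isUnit_B`);
* `ObjMonoid.unitHom : O^▷(A) →* B(A_D)`, injective (`unitHom_injective`) — "regard `O^⊳(−)` as a
  subfunctor of `B`" (Thm. 2.4 (i) proof, p. 20);
* the conjugation action `MulDistribMulAction (Aut A) (ObjMonoid d A)`, `α • f := α ∘ f ∘ α⁻¹`
  (diagrammatic `α.inv ≫ f ≫ α.hom`; the LEFT action for Mathlib's multiplication on `Aut A`), with
  `unitHom (α • f) = Base(α⁻¹)^* (unitHom f)` (abc-iut's `ModelFrobenioid.unit_conj'`) and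
  "automorphisms with the same `Base` act identically" (`smul_eq_of_baseMap_eq`, = [FrdII] Thm. 1.2 (ii)
  first clause, abc-iut-L1-d4's `conj_eq_conj_of_mapIso_eq` in this packaging).
Nothing here concerns [IUTchIII]; no statement of [FrdII] is restated (the context itself is file D3).
-/

noncomputable section

namespace Literature.AlgebraicGeometry.Frobenioids

namespace PadicFrd

namespace Datum

open CategoryTheory Opposite Function

universe v u

variable {D : Type u} [Category.{v} D] {p : ℕ} [Fact p.Prime] (d : Datum D p) (A : d.frobenioid)

/-- **`O^▷(A)`** for an object `A` of the `p`-adic Frobenioid `C = d.frobenioid`: the base-identity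
linear endomorphisms of `A` ([FrdI] Def. 1.2 (ii); found's `PreFrobenioid.endSubmonoid` for the
structure functor `C → F_Φ`), as a type. [cite: MochizukiFrdII2008, Def 2.2 (i) p.17] -/
def ObjMonoid : Type (max u v) := ↥(PreFrobenioid.endSubmonoid d.structureFunctor A)

namespace ObjMonoid

variable {d A}

/-- The underlying endomorphism `A ⟶ A` of an element of `O^▷(A)`. [cite: MochizukiFrdI2008, Def. 1.2(ii) p.22] -/
def hom (f : ObjMonoid d A) : A ⟶ A := (show ↥(PreFrobenioid.endSubmonoid d.structureFunctor A) from f).1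

/-- Membership of the underlying endomorphism in `O^▷(A)`. [cite: MochizukiFrdI2008, Def. 1.2(ii) p.22] -/
theorem hom_mem (f : ObjMonoid d A) : f.hom ∈ PreFrobenioid.endSubmonoid d.structureFunctor A :=
  (show ↥(PreFrobenioid.endSubmonoid d.structureFunctor A) from f).2

/-- Constructor from a base-identity linear endomorphism. [cite: MochizukiFrdI2008, Def. 1.2(ii) p.22] -/
def mk (f : A ⟶ A) (hf : f ∈ PreFrobenioid.endSubmonoid d.structureFunctor A) : ObjMonoid d A :=
  show ↥(PreFrobenioid.endSubmonoid d.structureFunctor A) from ⟨f, hf⟩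

/-- `hom (mk f hf) = f`. [cite: MochizukiFrdI2008, Def. 1.2(ii) p.22] -/
@[simp] theorem hom_mk (f : A ⟶ A) (hf : f ∈ PreFrobenioid.endSubmonoid d.structureFunctor A) :
    (mk f hf).hom = f := rfl

/-- Elements of `O^▷(A)` are equal iff their underlying endomorphisms are.
[cite: MochizukiFrdI2008, Def. 1.2(ii) p.22] -/
@[ext] theorem ext {f g : ObjMonoid d A} (h : f.hom = g.hom) : f = g := Subtype.ext h

/-- The monoid structure of `O^▷(A)` (composition; Mathlib's `End A`). [cite: MochizukiFrdI2008, Def. 1.2(ii) p.22] -/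
instance instMonoid : Monoid (ObjMonoid d A) :=
  inferInstanceAs (Monoid ↥(PreFrobenioid.endSubmonoid d.structureFunctor A))

/-- `hom (f * g) = g.hom ≫ f.hom` (the multiplication of `End A`). [cite: MochizukiFrdI2008, Def. 1.2(ii) p.22] -/
theorem hom_mul (f g : ObjMonoid d A) : (f * g).hom = g.hom ≫ f.hom := rfl

/-- `hom 1 = 𝟙 A`. [cite: MochizukiFrdI2008, Def. 1.2(ii) p.22] -/
theorem hom_one : (1 : ObjMonoid d A).hom = 𝟙 A := rfl

/-! ### The rational-function map `O^▷(A) → B(A_D)` -/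

/-- **"Regard `O^⊳(−)` as a subfunctor of `B`"** (Thm. 2.4 (i) proof p. 20; [FrdI] Thm. 5.2 (i)): the
rational-function map `f = (1, id, Div f, u_f) ↦ u_f`, a monoid homomorphism `O^▷(A) → B(A_D)`
(multiplicativity: abc-iut-L1-t4's `unit_comp_of_mem`). [cite: MochizukiFrdII2008, Thm 2.4 (i) p.20] -/
def unitHom : ObjMonoid d A →* d.B.obj (op A.base) where
  toFun f := ModelFrobenioid.unit f.hom
  map_one' := rfl
  map_mul' f g := by
    change ModelFrobenioid.unit (g.hom ≫ f.hom) = ModelFrobenioid.unit f.hom * ModelFrobenioid.unit g.hom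
    exact d.unit_comp_of_mem f.hom_mem g.hom_mem

/-- Unfolding `unitHom`. [cite: MochizukiFrdII2008, Thm 2.4 (i) p.20] -/
@[simp] theorem unitHom_apply (f : ObjMonoid d A) : unitHom f = ModelFrobenioid.unit f.hom := rfl

/-- `O^▷(A) → B(A_D)` is injective (a base-identity linear endomorphism is determined by its rational
function, abc-iut-L1-t4's `eq_of_mem_of_unit_eq`). [cite: MochizukiFrdII2008, Thm 2.4 (i) p.20] -/
theorem unitHom_injective : Injective (unitHom : ObjMonoid d A →* d.B.obj (op A.base)) :=
  fun f g h => ext (d.eq_of_mem_of_unit_eq f.hom_mem g.hom_mem h)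

/-- **`O^▷(A)` is commutative** ([FrdI] Rmk. 1.3.1; here: it embeds into the commutative `B(A_D)`).
[cite: MochizukiFrdII2008, Def 2.2 (i) p.17] -/
instance instCommMonoid : CommMonoid (ObjMonoid d A) :=
  { instMonoid with
    mul_comm := fun f g => unitHom_injective (by rw [map_mul, map_mul, mul_comm]) }

/-- **`O^▷(A)` is cancellative** (`B(A_D)` is a group: abc-iut-L1-t4's `isUnit_B`).
[cite: MochizukiFrdII2008, Def 2.2 (i) p.17] -/
instance instIsCancelMul : IsCancelMul (ObjMonoid d A) where
  mul_left_cancel a b c habc := by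
    apply unitHom_injective
    have h' := congrArg unitHom habc
    simp only [map_mul] at h'
    exact (d.isUnit_B _ _).mul_left_cancel h'
  mul_right_cancel a b c habc := by
    apply unitHom_injective
    have h' := congrArg unitHom habc
    simp only [map_mul] at h'
    exact (d.isUnit_B _ _).mul_right_cancel h'

/-! ### The conjugation action of `Aut_C(A)` -/

/-- The conjugate `α ∘ f ∘ α⁻¹` of `f ∈ O^▷(A)` by `α ∈ Aut_C(A)` lies in `O^▷(A)`
(`ModelFrobenioid.baseMap_conj'`, `degFr_conj'`). [cite: MochizukiFrdII2008, Def 2.2 (i) p.17] -/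
theorem conj_mem (α : Aut A) (f : ObjMonoid d A) :
    α.inv ≫ f.hom ≫ α.hom ∈ PreFrobenioid.endSubmonoid d.structureFunctor A :=
  ⟨ModelFrobenioid.baseMap_conj' α f.hom_mem.1, ModelFrobenioid.degFr_conj' α f.hom_mem.2⟩

/-- **"the natural action [by conjugation] of `Aut_C(A)` on `O^⊳(A)`"** (Def. 2.2 p. 17):
`α • f := α ∘ f ∘ α⁻¹` (diagrammatic `α.inv ≫ f ≫ α.hom` — the left action for Mathlib's group law
`x * y = y ≪≫ x` on `Aut A`), by monoid automorphisms. [cite: MochizukiFrdII2008, Def 2.2 (i) p.17] -/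
instance instMulDistribMulAction : MulDistribMulAction (Aut A) (ObjMonoid d A) where
  smul α f := mk (α.inv ≫ f.hom ≫ α.hom) (conj_mem α f)
  one_smul f := ext (by
    change 𝟙 A ≫ f.hom ≫ 𝟙 A = f.hom
    simp)
  mul_smul x y f := ext (by
    change (x * y).inv ≫ f.hom ≫ (x * y).hom = x.inv ≫ (y.inv ≫ f.hom ≫ y.hom) ≫ x.hom
    rw [Aut.Aut_mul_def, Iso.trans_inv, Iso.trans_hom]
    simp only [Category.assoc])
  smul_mul α f g := ext (by
    change α.inv ≫ (g.hom ≫ f.hom) ≫ α.hom = (α.inv ≫ g.hom ≫ α.hom) ≫ (α.inv ≫ f.hom ≫ α.hom)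
    simp only [Category.assoc, Iso.hom_inv_id_assoc])
  smul_one α := ext (by
    change α.inv ≫ 𝟙 A ≫ α.hom = 𝟙 A
    simp)

/-- Unfolding the action: `(α • f).hom = α.inv ≫ f.hom ≫ α.hom`. [cite: MochizukiFrdII2008, Def 2.2 (i) p.17] -/
@[simp] theorem hom_smul (α : Aut A) (f : ObjMonoid d A) : (α • f).hom = α.inv ≫ f.hom ≫ α.hom := rfl

/-- **The action on rational functions**: `u_{α • f} = Base(α⁻¹)^* u_f` (abc-iut's
`ModelFrobenioid.unit_conj'`: the twist `u_α` cancels). [cite: MochizukiFrdII2008, Def 2.2 (i) p.17] -/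
theorem unitHom_smul (α : Aut A) (f : ObjMonoid d A) :
    unitHom (α • f) = pull d.B (ModelFrobenioid.baseMap α.inv) (unitHom f) :=
  ModelFrobenioid.unit_conj' α f.hom_mem.1 f.hom_mem.2

/-- **[FrdII] Thm. 1.2 (ii), first clause, in this packaging**: automorphisms with the same image in
`Aut_D(A_D)` act identically on `O^▷(A)` (abc-iut's `ModelFrobenioid.conj_eq_of_baseMap_eq`; cf.
abc-iut-L1-d4's `conj_eq_conj_of_mapIso_eq` through `Aut_{D₀}(A₀)`).
[cite: MochizukiFrdII2008, Thm 1.2 (ii) p.9] -/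
theorem smul_eq_of_baseMap_eq {α α' : Aut A}
    (h : ModelFrobenioid.baseMap α.hom = ModelFrobenioid.baseMap α'.hom) (f : ObjMonoid d A) :
    α • f = α' • f :=
  ext (ModelFrobenioid.conj_eq_of_baseMap_eq h f.hom_mem.1 f.hom_mem.2)

end ObjMonoid

end Datum

end PadicFrd

end Literature.AlgebraicGeometry.Frobenioids

end
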